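import Summits.BirchSwinnertonDyer.Rank1Residual.AdditivePotMult.QuadraticBaseChangeDefectOverC
import Summits.BirchSwinnertonDyer.Rank1Residual.AdditivePotMult.TwistSupplyX3NoMilne
import HarnessLib

/-!
# X3♯(M) / X4(M) ∧ (ram): ONE quadratic field over which `BSD(E,p)` ⟺ the over-`K` input, WITHOUT
# MILNE — additive-p1's `TwistSupplyIff` re-issued with `{hMilneC} ↦ ∅`
# (row T-MIL-UNI, FILE U-7; seat n1011-p01 GEN 10)

HONEST FRAMING (cell `b2b-bsdres`, run/shared/lean/b2b/bsd-rank1-residual/, verbatim in every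
file): the goal of the cell is to DELETE the COMBINATION-SHAPED residual classes of the
Birch–Swinnerton-Dyer formula for ALL analytic-rank `≤ 1` elliptic curves over `ℚ` — "full BSD
formula for every rank `≤ 1` curve in class `C`" assembled STRICTLY from published theorems — so
that the rank-`≤ 1` remainder becomes exactly the CONSTRUCTION-SHAPED classes, which are TYPED
(missing-input `Prop`s), NOT attempted. This is not "finishing BSD". Sub-classes X3♯(M) / X4(M)
(additive, potentially multiplicative prime; base-change-and-descend): a RESEARCH ROUTE; they stay
CONSTRUCTION-SHAPED; nothing is booked by this file; no mark / label moved. THEOREMS ONLY: no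
definition, no named fact, no `sorry`.

## What (row T-MIL-UNI, FILE U-7)

additive-p1's `TwistSupplyIff.ClassX3M.exists_quadraticField_bsdp_iff` and
`ClassX4M.exists_quadraticField_bsdp_iff_of_ram` exhibit, for every X3♯(M) pair resp. every X4(M) ∧ (ram)
pair of analytic rank `≤ 1`, ONE quadratic field `K` (with its rank-zero `p`-multiplicative twist) over
which `MissingPPartOverCAt (W.baseChange K) p ↔ BSDp W p` — the typed over-`K` input is EXACTLY what is
missing — using Milne's identity `hMilneC` (A73) for the exactness. FILE U-5's
`missingPPartOverCAt_baseChange_iff_bsdp_noMilne` gives the exactness WITHOUT Milne on the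
odd-discriminant supply of FILES U-3 / U-4b; the two theorems are re-issued with binder diff EXACTLY
`{hMilneC} ↦ ∅` (X3♯: `d_K` odd is part of the field produced; the gvpar twist is U-4b's).

HONEST LIMITS: X3♯(M)/X4(M) stay CONSTRUCTION-SHAPED; closes no class; moves no mark; 0 facts.

References: J. S. Milne, Invent. Math. 17 (1972) §1 Thm. 1 [Milne1972ArithmeticAV] (the fact
REMOVED); C. Skinner, Pacific J. Math. 283 (2016) Thm. C [Skinner2016PacificMC]; R. Greenberg,
V. Vatsal, Invent. Math. 142 (2000) [GreenbergVatsal2000]; J. Hoffstein, W. Luo, Math. Res. Lett. 4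
(1997) [HoffsteinLuo1997].
-/

noncomputable section

open scoped Classical

open WeierstrassCurve Literature.NumberTheory.EllipticCurves
  Literature.NumberTheory.EllipticCurves.ModularForms
  Literature.NumberTheory.EllipticCurves.Rank1Residual
  Literature.NumberTheory.EllipticCurves.Rank1Residual.Typed
  Literature.NumberTheory.EllipticCurves.GreenbergVatsal2000
  Literature.NumberTheory.EllipticCurves.Wuthrich2014
  Literature.NumberTheory.EllipticCurves.SteinWuthrich2013
  IsDedekindDomain Rat.HeightOneSpectrum NumberField

namespace Summit.BirchSwinnertonDyer.Rank1Residual.AdditivePotMult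

section IffNoMilne

variable {W : WeierstrassCurve ℚ} [W.IsElliptic] {p : ℕ} [hp : Fact p.Prime]

/-- **X3♯(M): one quadratic field over which `BSD(E,p)` ⟺ the over-`K` input — for every pair,
WITHOUT MILNE.** For `(E,p) ∈ X3♯(M)` (`W` globally minimal) of analytic rank `≤ 1` there is a
quadratic field `K` (odd discriminant), with a globally minimal model `W_d` of `E^{(d_K)}` that is
multiplicative at `p`, satisfies gvpar and has analytic rank `0`, such that
`MissingPPartOverCAt (W.baseChange K) p ↔ BSDp W p`. additive-p1's
`TwistSupplyIff.ClassX3M.exists_quadraticField_bsdp_iff` with `hMilneC` REMOVED: the twist of FILE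
U-4b (`ClassX3M.exists_gvPar_rankZero_mult_twist_oddDiscr`), the X2a closure
`bsdp_twist_of_rankZero_gvPar` (binders `hGV hWu hJs hJn hHs hHn hpar hGS`), and FILE U-5's exactness
`missingPPartOverCAt_baseChange_iff_bsdp_noMilne`. [cite: GreenbergVatsal2000, Thm. 1.3]
[cite: Wuthrich2014, Thm. 16]
[cite: Milne1972ArithmeticAV, §1 Thm. 1 and §2 (through DokchitserDokchitserAnnals2010, §2.1, proof of Thm. 8)] -/
theorem ClassX3M.exists_quadraticField_bsdp_iff_noMilne [W.IsGloballyMinimal]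
    (hGV : lambdaMu_multiplicative_of_gvPar)
    (hWu : thm16_charIdeal_dvd_multiplicative_of_reducible)
    (hJs : thm61_splitMultiplicative) (hJn : thm61_nonsplitMultiplicative)
    (hHs : exists_isSplitMultCanonical) (hHn : exists_isMultCanonical)
    (hGZK : rank_eq_analyticRank_of_analyticRank_le_one) (hmod : hasEntireLFunction_rat)
    (hpar : nonempty_modularParametrizationData)
    (hnf : exists_isNewformOf) (hHL : HoffsteinLuo1997_exists_twist_L_one_ne_zero)
    (hGS : ∀ (V : WeierstrassCurve ℚ) [V.IsElliptic] [V.IsGloballyMinimal],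
      greenberg_stevens (W := V) (p := p))
    (hX : ClassX3M W p) (hr : W.analyticRank ≤ 1) :
    ∃ (K : Type) (_ : Field K) (_ : NumberField K), Module.finrank ℚ K = 2 ∧
      (∃ (Wd : WeierstrassCurve ℚ) (_ : Wd.IsElliptic) (_ : Wd.IsGloballyMinimal),
        (∃ C : VariableChange ℚ, C • W.quadraticTwist (NumberField.discr K : ℚ) = Wd) ∧
        Mult Wd p ∧ GVPar Wd p ∧ Wd.analyticRank = 0) ∧
      (MissingPPartOverCAt (W.baseChange K) p ↔ BSDp W p) := by
  obtain ⟨K, iF, iN, Wd, iWd, iWdm, Cd, h2, hodd, hsq, hpd, hWd, hmult, hgv, hr0, hS⟩ :=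
    hX.exists_gvPar_rankZero_mult_twist_oddDiscr hnf hHL
  have hD : (NumberField.discr K : ℚ) ≠ 0 := by exact_mod_cast NumberField.discr_ne_zero K
  obtain ⟨hp2, hred, -⟩ := classX2_twist_of_classX3M hX hD ⟨Cd, hWd⟩ hmult
  have hd : BSDp Wd p :=
    bsdp_twist_of_rankZero_gvPar p Wd hGV hWu hJs hJn hHs hHn hGZK hmod hpar (hGS Wd) hp2 hmult hred hgv
      hr0
  exact ⟨K, iF, iN, h2, ⟨Wd, iWd, iWdm, ⟨Cd, hWd⟩, hmult, hgv, hr0⟩,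
    missingPPartOverCAt_baseChange_iff_bsdp_noMilne W p K Wd hGZK hmod h2 hodd hsq hpd hWd hr
      (by rw [hr0]; exact zero_le_one) hp2 hmult hS hd⟩

/-- **X4(M) ∧ (ram): one quadratic field over which `BSD(E,p)` ⟺ the over-`K` input — for every
pair, WITHOUT MILNE.** For `(E,p) ∈ X4(M)` (`W` globally minimal) of analytic rank `≤ 1` with `Ram W p`
there is a quadratic field `K` (odd discriminant), with a globally minimal model `W_d` of `E^{(d_K)}`
that is multiplicative and irreducible at `p`, satisfies (ram) and has analytic rank `0`, such that
`MissingPPartOverCAt (W.baseChange K) p ↔ BSDp W p`. additive-p1's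
`TwistSupplyIff.ClassX4M.exists_quadraticField_bsdp_iff_of_ram` with `hMilneC` REMOVED: FILE U-3's
odd-discriminant twist, Skinner 2016 Thm. C for it (`bsdp_twist_of_rankZero_ram`, `hSk`), FILE U-5's
exactness. [cite: Skinner2016PacificMC, Thm. C (§1), footnote 1, §2.5]
[cite: Milne1972ArithmeticAV, §1 Thm. 1 and §2 (through DokchitserDokchitserAnnals2010, §2.1, proof of Thm. 8)] -/
theorem ClassX4M.exists_quadraticField_bsdp_iff_of_ram_noMilne [W.IsGloballyMinimal]
    (hGZK : rank_eq_analyticRank_of_analyticRank_le_one) (hmod : hasEntireLFunction_rat)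
    (hSk : Skinner2016.thmC_padicValRat_bsd_rank_zero)
    (hnf : exists_isNewformOf) (hHL : HoffsteinLuo1997_exists_twist_L_one_ne_zero)
    (hX : ClassX4M W p) (hr : W.analyticRank ≤ 1) (hram : Ram W p) :
    ∃ (K : Type) (_ : Field K) (_ : NumberField K), Module.finrank ℚ K = 2 ∧
      (∃ (Wd : WeierstrassCurve ℚ) (_ : Wd.IsElliptic) (_ : Wd.IsGloballyMinimal),
        (∃ C : VariableChange ℚ, C • W.quadraticTwist (NumberField.discr K : ℚ) = Wd) ∧
        Mult Wd p ∧ Irr Wd p ∧ Ram Wd p ∧ Wd.analyticRank = 0) ∧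
      (MissingPPartOverCAt (W.baseChange K) p ↔ BSDp W p) := by
  obtain ⟨K, iF, iN, Wd, iWd, iWdm, Cd, h2, hodd, hsq, hpd, hWd, hmult, hirr, hr0, hS, hramT⟩ :=
    hX.exists_rankZero_mult_twist_oddDiscr hnf hHL
  have hramd : Ram Wd p := hramT hram
  have hd : BSDp Wd p :=
    bsdp_twist_of_rankZero_ram p Wd hSk hGZK hmod hX.p_ne_two hmult hirr hramd hr0
  exact ⟨K, iF, iN, h2, ⟨Wd, iWd, iWdm, ⟨Cd, hWd⟩, hmult, hirr, hramd, hr0⟩,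
    missingPPartOverCAt_baseChange_iff_bsdp_noMilne W p K Wd hGZK hmod h2 hodd hsq hpd hWd hr
      (by rw [hr0]; exact zero_le_one) hX.p_ne_two hmult hS hd⟩

end IffNoMilne

end Summit.BirchSwinnertonDyer.Rank1Residual.AdditivePotMult

end
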